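import Literature.MathematicalPhysics.QuantumFieldTheory.Balaban1983to89.B8SockHFPRD
import Literature.MathematicalPhysics.QuantumFieldTheory.Balaban1983to89.B8SockHFPCubeMember
import Literature.MathematicalPhysics.QuantumFieldTheory.Balaban1983to89.B8Prop6CubeMemberExists

/-!
# `Balaban1983to89.B8SockHFPCubeMemberRD` — [Balaban1985RegularSpaces] PROPOSITION 6 (p. 99) AT THE CONCRETE CUBE MEMBER `{□_j}` OF (1.131)
# MODULO EXACTLY TWO OBJECT-BOUND SOCKETS: the [4]-letters socket in its REPAIRED, print-domain form `SockLettersRD` (W8∕W8′ fixed) and the b9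
# socket `SB9all` — the Prop.-5 EXISTENCE sockets at the member come from the letters (n05-d's `exists_threshold_sockHFP_pairRD` with the
# cube member's laws discharged), (1.59) from the b9 ∃-package, and Proposition 6 needs no uniqueness socket (`B8Prop6CubeMemberExists`)

statement-level skeleton of published theorems with citation tags; proofs where landed; nothing here is a claim about the
Yang–Mills mass gap

T. Bałaban, *Spaces of regular gauge field configurations on a lattice and gauge fixing conditions*, Commun. Math. Phys. **99**
(1985) 75–102 `[Balaban1985RegularSpaces]` ("B8"), Prop. 6 p. 99, Prop. 5 p. 94, (1.59) p. 86, (1.68) p. 88, (1.131) p. 99; [4] =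
T. Bałaban, *Propagators for lattice gauge theories in a background field*, Commun. Math. Phys. **99** (1985) 389–434
`[Balaban1985BackgroundPropagators]`, Thm 3.1 p. 397, (3.25) p. 394, Thm 3.3 p. 398.

CITATION HEADER (lean-in-tree rule).  Cell `pub-ymgap` (YM Track A, HUMAN RULING D-0062), DAG node N05 = [B8], seat `pub-ymgap-dag-n05-c`
(g2).  WHY THIS FILE.  The g0 module `B8SockHFPCubeMember` (§§2–3: `sockHFP_pair_cubeMember`, `prop6_cubeMember_of_letters`) fed the
[4]-letters socket `B8LeafModelZdSockLetters.SockLetters` into n05-d's `exists_threshold_sockHFP_pair`; referee flags W8∕W8′ (ref-A g12,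
kernel-certified) showed that socket — and its first repair `SockLettersR` — FALSE at every member with finite `Ω₀`, i.e. at every cube
member (full-space inverse laws of `G′` against «`g f = 0` off `Ω₀`»).  n05-d's second repair `B8SockLettersRD.SockLettersRD` (p466338;
right-inverse law POINTWISE ON `Ω₀`, `C` in range form, no total left-inverse — «exactly the two domain restrictions» of [4] p. 394 ∕
Thm 3.1) and its provider `B8SockHFPRD.exists_threshold_sockHFP_pairRD` restore the road.  THIS FILE re-points the cube member to it and,
using `B8Prop6CubeMemberExists` (Proposition 6 needs only Theorem 4's EXISTENCE half — no uniqueness socket, whose provider is scoped to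
`Ω₀ = T`), lands PROPOSITION 6 AT THE CUBE MEMBER MODULO EXACTLY TWO SOCKETS:
* §1 **`sockHFP_pair_cubeMemberRD`** — `SockHFP₀ ∧ SockHFP` at `(cubeFam false, cubeLamS, cubeLamB)` from `SockLettersRD` + `SB9all` at the
  member (the six member laws by `B8CubeMemberZd.hΩ_cubeFam`∕`hbox_cubeLamB`∕`hclass_cubeLamB` and `B8SockHFPCubeMember.htw_cubeLamS`∕
  `h8lt_cubeLamS`∕`h8top_cubeLamS` BY NAME).
* §2 **`prop6_cubeMember_of_lettersRD₂`** — PROPOSITION 6 (p. 99) at the cube member WITH PRINT'S HYPOTHESES («U₀, U₀′, □, □̃ as described,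
  7dL²Mα₀ ≤ c₁» + print's implicit `L ≤ dM`, `11d < M`), conclusion (1.135)∕(1.136)₁∕(1.138) with print's constant `7dL²B₁Mα₀`, MODULO
  `SockLettersRD` (threshold `c_L`) and `SB9all` (`SockB9P3` at every truncation, threshold `c_{B9}`) ONLY — via
  `B8Prop6CubeMemberExists.prop6_asPrinted_cubeMember_of_HFP₃` + §1 + `B8LeafSocketsB9.sockH59_of_allLevels`.

HONEST SCOPE.  Plumbing BY NAME; the two sockets are displayed hypotheses (object-bound: the letters of [4] Thms 3.1–3.3 at the cube
member's backgrounds, [4] Thm 3.3 in Prop. 3's frame); whether `SockLettersRD` is SATISFIABLE at a cube member is the supplier's question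
(the certified obstructions W8∕W8′ are gone; nothing more is claimed); nothing of Props 3∕5∕6 proved beyond composition; count-neutral;
N05 NOT discharged; `T_η ↦ ℤᵈ`; one finite `T⁴` programme at fixed `ε`, Bałaban as printed — nothing continuum ∕ ℝ⁴ ∕ OS ∕ mass-gap ∕
Clay.  No `sorry`, no `axiom`, no `instance`, no `notation`.  Unit `pub-ymgap-dag-n05-c` (g2), 2026-08-26.
-/

noncomputable section

namespace Literature.MathematicalPhysics.QuantumFieldTheory.Balaban1983to89.B8SockHFPCubeMemberRD

open B7Prop1Explicit B7Prop2Explicit B7Prop1Local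
open B8Ineq130 (tlo thi)
open B8LeafModelZd3 (SockB9P3)
open B8LeafModelZdOfHFP (SockHFP₀ SockHFP)
open B8SockLettersRD (SockLettersRD)
open B8SockHFPRD (exists_threshold_sockHFP_pairRD)
open B8Eq131Cubes (tcube tLo tHi ctr)
open B8Eq131CubesAdmissible (cubeFam)
open B8CubeMemberZd (cubeLamS cubeLamB hΩ_cubeFam hbox_cubeLamB hclass_cubeLamB)
open B8SockHFPCubeMember (htw_cubeLamS h8lt_cubeLamS h8top_cubeLamS)

export B7Prop1Explicit (Site)

variable {d : ℕ}

/-! ## §1 The Prop.-5 existence sockets at the cube member from the repaired letters socket and the b9 socket -/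

section Sockets

variable {𝔸 : Type*} [CStarAlgebra 𝔸] [Nontrivial 𝔸]

/-- **`SockHFP₀` AND `SockHFP` AT THE CONCRETE CUBE MEMBER FROM `SockLettersRD` + `SB9all` ALONE** — n05-d's repaired provider
`B8SockHFPRD.exists_threshold_sockHFP_pairRD` with its six member laws DISCHARGED for `(Ω, Λs, Λb) := (cubeFam false, cubeLamS, cubeLamB)`:
ONE threshold `cF(d, L, B₀, B₀′, B₀′_H, B₂′, B_G, B_R, c_{B9}, c_L) > 0` such that for every cube datum `(η > 0, k ≥ 1, a, M, ρ ≥ L)` the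
repaired [4]-letters socket at the member and the b9 socket at every truncation give both Prop.-5 fixed-point sockets at the member.
[cite: Balaban1985RegularSpaces, Prop. 5 (1.106)–(1.108) p.94, (1.68) p.88, (1.131) p.99; Balaban1985BackgroundPropagators, Thm 3.1 p.397, (3.25) p.394] -/
theorem sockHFP_pair_cubeMemberRD (hd2 : 2 ≤ d) {L : ℕ} (hL : 2 ≤ L) {B₀ B₀' B₀'H B₂' BG BR cB9 cL : ℝ} (hB₀ : 0 < B₀)
    (hB₀' : 0 < B₀') (hB : 2 ≤ 5 * (d : ℝ) * L * B₀) (hB₀'H : 0 < B₀'H) (hB₂' : 0 ≤ B₂') (hBG : 0 ≤ BG) (hBR : 0 ≤ BR)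
    (hcB9 : 0 < cB9) (hcL : 0 < cL) (hfree : 3 * (2 * (d : ℝ) * (L : ℝ) ^ 2) * BG * BR ≤ B₀') :
    ∃ cF : ℝ, 0 < cF ∧ ∀ {η : ℝ}, 0 < η → ∀ {k : ℕ}, 1 ≤ k → ∀ (a : Site d) (M : ℕ) {ρ : ℕ}, L ≤ ρ →
      ∀ {B₀β β : ℝ} {len : Site d → ℝ},
      SockLettersRD (𝔸 := 𝔸) L BG BR B₀'H B₂' cL η k (cubeFam false L a M ρ k) (cubeLamS L a M ρ k) →
      (∀ m, m ≤ k → SockB9P3 (𝔸 := 𝔸) L B₀ B₀β cB9 β len η m (cubeFam false L a M ρ k) (cubeLamS L a M ρ k) (cubeLamB L a M ρ k)) →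
        SockHFP₀ (𝔸 := 𝔸) L B₀ B₀' cF η k (cubeFam false L a M ρ k) (cubeLamS L a M ρ k) ∧
        SockHFP (𝔸 := 𝔸) L B₀ B₀' cF η k (cubeFam false L a M ρ k) (cubeLamS L a M ρ k) := by
  have hL1 : 1 ≤ L := le_trans (by norm_num) hL
  obtain ⟨cF, hcF, H⟩ := exists_threshold_sockHFP_pairRD (𝔸 := 𝔸) hd2 hL hB₀ hB₀' hB hB₀'H hB₂' hBG hBR hcB9 hcL hfree
  refine ⟨cF, hcF, ?_⟩
  intro η hη k hk a M ρ hρL B₀β β len SLet SB9all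
  exact H hη hk (hΩ_cubeFam hL1 a M hρL k) (hbox_cubeLamB L a M ρ k) (hclass_cubeLamB L a M ρ k) (htw_cubeLamS hL1 a M ρ k)
    (h8lt_cubeLamS L a M ρ k) (h8top_cubeLamS hL1 a M ρ k) SLet SB9all

end Sockets

/-! ## §2 Proposition 6 at the cube member from exactly two object-bound sockets -/

section Prop6

variable {𝔸 : Type} [CStarAlgebra 𝔸] [Nontrivial 𝔸]

/-- **PROPOSITION 6 (p. 99) AT THE CONCRETE CUBE MEMBER WITH PRINT'S HYPOTHESES, MODULO EXACTLY TWO SOCKETS AT THE MEMBER** — the repaired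
[4]-letters socket `SockLettersRD` (threshold `c_L`) and the b9 socket at every truncation `SB9all` (`SockB9P3`, threshold `c_{B9}`):
`B8Prop6CubeMemberExists.prop6_asPrinted_cubeMember_of_HFP₃` (three EXISTENCE sockets, no uniqueness socket) with `SockHFP₀`∕`SockHFP`
DISCHARGED by `sockHFP_pair_cubeMemberRD` (§1) and `SockH59` read from the b9 ∃-package by `B8LeafSocketsB9.sockH59_of_allLevels`.  ONE
threshold `c₁ > 0` on `(d, L, B₀, B₀′, B₀′_H, B₂′, B_G, B_R, c_{B9}, c_L)`; conclusion as there: ∃ unitary `u` = 1 off `□₀` with (1.29) at the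
member, `U₁ = U₀″^{u⁻¹}` in the Landau gauge of record ((1.138)), `U₁ = e^{iηA}` with `A` Hermitian and `Lʲη|A| ≤ 7dL²B₁Mα₀` on the bonds of the
plaquettes touching `□_j` ((1.136)₁, `B₁ = 5dLB₀`), `w = v⁻¹u` unitary and `U₀^{w⁻¹} = U₁` on `□̃` ((1.135)).
[cite: Balaban1985RegularSpaces, Prop. 6 (1.135)–(1.138) p.99, Prop. 5 p.94, (1.59) p.86; Balaban1985BackgroundPropagators, Thm 3.1 p.397, Thm 3.3 p.398] -/
theorem prop6_cubeMember_of_lettersRD₂ (hd2 : 2 ≤ d) {L : ℕ} (hL : 2 ≤ L) {B₀ B₀' B₀'H B₂' BG BR cB9 cL : ℝ} (hB₀ : 0 < B₀)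
    (hB₀' : 0 < B₀') (hB : 2 ≤ 5 * (d : ℝ) * L * B₀) (hB₀'H : 0 < B₀'H) (hB₂' : 0 ≤ B₂') (hBG : 0 ≤ BG) (hBR : 0 ≤ BR)
    (hcB9 : 0 < cB9) (hcL : 0 < cL) (hfree : 3 * (2 * (d : ℝ) * (L : ℝ) ^ 2) * BG * BR ≤ B₀') :
    ∃ c₁ : ℝ, 0 < c₁ ∧ ∀ (η : ℝ), 0 < η → ∀ (k : ℕ), 1 ≤ k → ∀ (a : Site d) (M ρ : ℕ), L ≤ ρ → ρ ≤ M → 11 * (d : ℝ) < M →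
      (L : ℝ) ≤ d * M →
      ∀ {B₀β β : ℝ} {len : Site d → ℝ},
      SockLettersRD (𝔸 := 𝔸) L BG BR B₀'H B₂' cL η k (cubeFam false L a M ρ k) (cubeLamS L a M ρ k) →
      (∀ m, m ≤ k → SockB9P3 (𝔸 := 𝔸) L B₀ B₀β cB9 β len η m (cubeFam false L a M ρ k) (cubeLamS L a M ρ k) (cubeLamB L a M ρ k)) →
      ∀ (U₀ : Site d → Fin d → 𝔸ˣ), (∀ x κ, U₀ x κ ∈ unitaryUnits 𝔸) → ∀ (α₀ : ℝ), 0 < α₀ →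
      ∀ (Ω : ℕ → Set (Site d)), B8Ineq132.InAk L k η α₀ Ω U₀ → tcube L a M ρ k ⊆ Ω (k - 1) →
      7 * d * (L : ℝ) ^ 2 * M * α₀ ≤ c₁ →
      ∃ u : Site d → 𝔸ˣ, (∀ x, u x ∈ unitaryUnits 𝔸) ∧ (∀ x, x ∉ cubeFam false L a M ρ k 0 → u x = 1) ∧
        B8Eq119TwistedAxial.Restr129 L k (cubeLamS L a M ρ k k) (1 : Site d → Fin d → 𝔸ˣ) u ∧
        B8Eq138LandauZd.IsLandau138W L k η (cubeFam false L a M ρ k 0) (cubeLamS L a M ρ k k) (1 : Site d → Fin d → 𝔸ˣ)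
          (gaugeAct u⁻¹ (B8Ineq133.cutFixed L (tLo a ρ) (tHi a M ρ) U₀ k (ctr a M))) ∧
        (∀ j, j ≤ k → ∀ b ∈ {b : Site d × Fin d | B8Eq140Level.SideTouches (cubeFam false L a M ρ k j) b.1 b.2},
          gaugeAct u⁻¹ (B8Ineq133.cutFixed L (tLo a ρ) (tHi a M ρ) U₀ k (ctr a M)) b.1 b.2 =
              B8Eq184Proof.cfgExp η (B8Eq138LandauZd.logCfg η (gaugeAct u⁻¹ (B8Ineq133.cutFixed L (tLo a ρ) (tHi a M ρ) U₀ k (ctr a M)))) b.1 b.2 ∧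
            IsSelfAdjoint (B8Eq138LandauZd.logCfg η (gaugeAct u⁻¹ (B8Ineq133.cutFixed L (tLo a ρ) (tHi a M ρ) U₀ k (ctr a M))) b.1 b.2) ∧
            ‖B8Eq138LandauZd.logCfg η (gaugeAct u⁻¹ (B8Ineq133.cutFixed L (tLo a ρ) (tHi a M ρ) U₀ k (ctr a M))) b.1 b.2‖ ≤
              (7 * d * (L : ℝ) ^ 2 * (5 * (d : ℝ) * L * B₀) * M * α₀) * ((L : ℝ) ^ j * η)⁻¹) ∧
        (∀ x, ((B8Eq115GaugeFixing.localGauge L (tLo a ρ) (tHi a M ρ) U₀ k (ctr a M))⁻¹ * u) x ∈ unitaryUnits 𝔸) ∧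
        AgreeOn (tlo L (tLo a ρ) k) (thi L (tHi a M ρ) k)
          (gaugeAct ((B8Eq115GaugeFixing.localGauge L (tLo a ρ) (tHi a M ρ) U₀ k (ctr a M))⁻¹ * u)⁻¹ U₀)
          (gaugeAct u⁻¹ (B8Ineq133.cutFixed L (tLo a ρ) (tHi a M ρ) U₀ k (ctr a M))) := by
  have hL1 : 1 ≤ L := le_trans (by norm_num) hL
  have hd1 : 1 ≤ d := le_trans (by norm_num) hd2
  obtain ⟨cF, hcF, HF⟩ := sockHFP_pair_cubeMemberRD (𝔸 := 𝔸) hd2 hL hB₀ hB₀' hB hB₀'H hB₂' hBG hBR hcB9 hcL hfree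
  -- the (1.59) threshold delivered by the b9 ∃-package adapter
  set c59 : ℝ := min cB9 (cB9 / (2 * (L * (5 * (d : ℝ) * L * B₀)) + 8 * (8 * B₀' * (5 * (d : ℝ) * L * B₀)))) with hc59def
  have hc59 : 0 < c59 := by
    have hden : 0 < 2 * (L * (5 * (d : ℝ) * L * B₀)) + 8 * (8 * B₀' * (5 * (d : ℝ) * L * B₀)) := by
      have hLpos : (0 : ℝ) < L := by exact_mod_cast lt_of_lt_of_le (by norm_num) hL
      have hdpos : (0 : ℝ) < d := by exact_mod_cast hd1
      positivity
    exact lt_min hcB9 (div_pos hcB9 hden)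
  obtain ⟨c₁, hc₁, H⟩ :=
    B8Prop6CubeMemberExists.prop6_asPrinted_cubeMember_of_HFP₃ (𝔸 := 𝔸) hd2 hL hB₀ hB₀' hB hcF hcF hc59
  refine ⟨c₁, hc₁, ?_⟩
  intro η hη k hk a M ρ hρL hρM hM hLdM B₀β β len SLet SB9all U₀ hU₀ α₀ hα Ω hA hT hc
  obtain ⟨SHFP₀, SHFP⟩ := HF hη hk a M hρL SLet SB9all
  have SH59 := B8LeafSocketsB9.sockH59_of_allLevels (𝔸 := 𝔸) hd1 hL1 hB₀ hB₀'.le hcB9 SB9all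
  exact H η hη k hk a M ρ hρL hρM hM hLdM SHFP₀ SHFP SH59 U₀ hU₀ α₀ hα Ω hA hT hc

#print axioms prop6_cubeMember_of_lettersRD₂

end Prop6

end Literature.MathematicalPhysics.QuantumFieldTheory.Balaban1983to89.B8SockHFPCubeMemberRD

end
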